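import Mathlib
import Literature.MathematicalPhysics.KineticTheory.FouriersLaw
import Literature.MathematicalPhysics.KineticTheory.LangevinChainHormander
import Literature.MathematicalPhysics.KineticTheory.LangevinChainGibbs
import HarnessLib

/-!
# Sketch — first lemmas of two crux-idea cards for `FiniteResponseOfUnique`
(crux item stmt-AtomisticToContinuum-0717; planner-cruxidea-…-0717-1-0, round 1)

Only SIGNATURES matter here (they must elaborate over existing declarations); proofs are `sorry`
except for two elementary calibration inequalities which are proved.

* Card A `unit-window-bismut-borrowed-decay`: adapted-energy Gronwall bound for the first
  variation of the pinned chain along a phase path (`firstVariation_adaptedEnergy_le`), resting on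
  the log-Lipschitz ratio bounds `|U'''| ≤ √(3lam/ω₂)·U''`, `|V'''| ≤ √(3β)·V''`
  (`pinned_abs_U3_le`, `pinned_abs_V3_le`, proved).
* Card B `bath-sobolev-response-series`: the two free identities in `L²(π_T)` that make the
  temperature perturbation `δ·(γ/2)(∂²_{p_0} - ∂²_{p_{N-1}})` summable without relative
  boundedness: the equilibrium dissipation identity (`equilibrium_dissipation_identity`) and the
  bath CCR identity `‖b* f‖² = ‖b f‖² + T⁻¹‖f‖²` (`bath_ccr_identity`).
-/

noncomputable section

open MeasureTheory Real Finset
open scoped BigOperators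

namespace Summit.AtomisticToContinuum.FouriersLaw.Cruxes.FiniteResponseOfUnique.Sketch

open Literature.MathematicalPhysics.KineticTheory.HeatConduction
open Literature.MathematicalPhysics.KineticTheory.HeatConduction.OscillatorChain

/-! ## Card A — calibration: the Hessian of the pinned chain is log-Lipschitz along the flow -/

/-- `|U'''(q)| = 6·lam·|q| ≤ √(3 lam/ω₂) · U''(q)` for `U(q) = ω₂q²/2 + lam q⁴/4`, `ω₂, lam > 0`
(AM–GM: `2√(3 lam ω₂)|q| ≤ ω₂ + 3 lam q²`). Written on the closed forms of the derivatives.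
This is what makes `d/dt log U''(q_t) ≤ √(3lam/ω₂)|p_t|`. -/
theorem pinned_abs_U3_le {ω₂ lam : ℝ} (hω : 0 < ω₂) (hl : 0 < lam) (q : ℝ) :
    |6 * lam * q| ≤ Real.sqrt (3 * lam / ω₂) * (ω₂ + 3 * lam * q ^ 2) := by
  have h3 : 0 < 3 * lam / ω₂ := by positivity
  set s := Real.sqrt (3 * lam / ω₂) with hs
  have hs0 : 0 < s := Real.sqrt_pos.2 h3
  have hs2 : s ^ 2 = 3 * lam / ω₂ := Real.sq_sqrt h3.le
  have hsω : s ^ 2 * ω₂ = 3 * lam := by rw [hs2]; field_simp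
  -- AM-GM in the form  6 lam |q| ≤ s (ω₂ + 3 lam q²)  ⟸  0 ≤ s ω₂ (|q| s - 1)²
  rw [abs_mul, abs_of_pos (by positivity : (0:ℝ) < 6 * lam)]
  have key : 0 ≤ s * ω₂ * (s * |q| - 1) ^ 2 := by positivity
  have hq2 : |q| ^ 2 = q ^ 2 := sq_abs q
  have e : s * (ω₂ + 3 * lam * q ^ 2) - 6 * lam * |q| = s * ω₂ * (s * |q| - 1) ^ 2 := by
    linear_combination (-s * |q| ^ 2 + 2 * |q|) * hsω + (-3 * s * lam) * hq2
  linarith [key, e]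

/-- `|V'''(r)| = 6β|r| ≤ √(3β) · V''(r)` for `V(r) = r²/2 + β r⁴/4`, `β > 0`. -/
theorem pinned_abs_V3_le {β : ℝ} (hβ : 0 < β) (r : ℝ) :
    |6 * β * r| ≤ Real.sqrt (3 * β) * (1 + 3 * β * r ^ 2) := by
  have := pinned_abs_U3_le (ω₂ := 1) (lam := β) one_pos hβ r
  simpa using this

/-! ## Card A — first lemma: adapted-energy Gronwall bound for the first variation

Along ANY phase path `x(s) = (q(s), p(s))` with `q̇ = p` (in particular along every sample path
of the Langevin chain, whose noise enters the `p`-equation only), a solution `v = (v_q, v_p)` of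
the first-variation equation `v̇_q = v_p`, `v̇_p = -Hess Φ(q(s)) v_q - γ W v_p` satisfies, for the
ADAPTED linearised energy `Q(s) = |v_p|² + ⟨v_q, Hess Φ(q(s)) v_q⟩` (positive definite since
`Hess Φ ≥ ω₂`, pinning!), the bound `Q(t) ≤ Q(0) · exp(C ∫₀ᵗ ∑ᵢ |pᵢ(s)| ds)` with
`C = max(√(3lam/ω₂), 2√(3β))` depending on the potentials only — NOT on `N`, `T`, the energy or
the path. Unit-window Jacobian moments are thus controlled by `E exp(C∫₀¹|p|) ≤ C_ε e^{εH(x)}`,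
which is all the Bismut/Malliavin smoothing step and HM Assumption 2 need; the infinite-horizon
Jacobian growth that breaks Hairer–Majda Thm 4.4 Assumption 5 never enters. -/
theorem firstVariation_adaptedEnergy_le {ω₂ lam β γ : ℝ} (hω : 0 < ω₂) (hl : 0 < lam)
    (hβ : 0 < β) (hγ : 0 ≤ γ) {N : ℕ}
    (x : ℝ → PhaseSpace N) (v : ℝ → PhaseSpace N)
    -- the base path has `q̇ = p`
    (hx : ∀ s i, HasDerivAt (fun r => (x r).1 i) ((x s).2 i) s)
    (hxc : ∀ i, Continuous fun s => (x s).2 i)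
    -- first-variation equation along the path
    (hvq : ∀ s i, HasDerivAt (fun r => (v r).1 i) ((v s).2 i) s)
    (hvp : ∀ s i, HasDerivAt (fun r => (v r).2 i)
      (-(∑ j, (pinnedChain ω₂ lam β γ).hessPotential N i j (x s).1 * (v s).1 j)
        - γ * bathWeight N i * (v s).2 i) s) :
    let Q : ℝ → ℝ := fun s => (∑ i, (v s).2 i ^ 2) +
      ∑ i, ∑ j, (pinnedChain ω₂ lam β γ).hessPotential N i j (x s).1 * (v s).1 i * (v s).1 j
    ∀ t, 0 ≤ t →
      Q t ≤ Q 0 * Real.exp (max (Real.sqrt (3 * lam / ω₂)) (2 * Real.sqrt (3 * β)) *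
        ∫ s in (0:ℝ)..t, ∑ i, |(x s).2 i|) := by
  sorry

/-! ## Card B — first lemma: the two free `L²(π_T)` identities

(1) Equilibrium dissipation identity: for the generator `L_{T,T}` with BOTH baths at `T` and the
Gibbs measure `π_T`, `∫ f · L_{T,T} f dπ_T = -γ T ∑_b W_b ∫ (∂_{p_b} f)² dπ_T` — the Liouville
part is antisymmetric, each Ornstein–Uhlenbeck bath is symmetric non-positive. It gives the
sandwich bounds `‖∂_{p_b}(z - L)⁻¹ ∂_{p_b}^*‖ ≤ (γT)⁻¹`, `‖∂_{p_b}(z-L)⁻¹ Π^⊥‖² ≤ ‖(z-L)⁻¹|_{L²₀}‖/(γT)`.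
(2) Bath CCR identity: with `b = ∂_{p_b}` and its `L²(π_T)`-adjoint `b* = -∂_{p_b} + p_b/T`,
`[b, b*] = T⁻¹`, i.e. `‖b* f‖² = ‖b f‖² + T⁻¹ ‖f‖²`: moving ONE of the two momentum derivatives
of the temperature perturbation `δ(γ/2)(b₀² - b_{N-1}²)` across costs one `b` and a zero-order
term — no polynomial weight, no maximal-regularity estimate. Both are stated against the
unnormalised density `e^{-H/T}` (`gibbsDensity`), for `C²` compactly supported `f`. -/
theorem equilibrium_dissipation_identity (ω₂ lam β γ : ℝ) (N : ℕ) {T : ℝ} (hT : 0 < T)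
    {f : PhaseSpace N → ℝ} (hf : ContDiff ℝ 2 f) (hfc : HasCompactSupport f) :
    ∫ x, f x * (pinnedChain ω₂ lam β γ).generator N T T f x *
        (pinnedChain ω₂ lam β γ).gibbsDensity N T x =
      -(γ * T) * ∑ i : Fin N, bathWeight N i *
        ∫ x, (partialP i f x) ^ 2 * (pinnedChain ω₂ lam β γ).gibbsDensity N T x := by
  sorry

theorem bath_ccr_identity (ω₂ lam β γ : ℝ) (N : ℕ) {T : ℝ} (hT : 0 < T) (i : Fin N)
    {f : PhaseSpace N → ℝ} (hf : ContDiff ℝ 2 f) (hfc : HasCompactSupport f) :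
    ∫ x, (-partialP i f x + x.2 i / T * f x) ^ 2 * (pinnedChain ω₂ lam β γ).gibbsDensity N T x =
      (∫ x, (partialP i f x) ^ 2 * (pinnedChain ω₂ lam β γ).gibbsDensity N T x) +
        T⁻¹ * ∫ x, f x ^ 2 * (pinnedChain ω₂ lam β γ).gibbsDensity N T x := by
  sorry

/-! ## Card B — calibration of the identification step: a hotter Gibbs state is sub-invariant

For ANY bath temperatures `T_L, T_R ≤ T'`, `∫ L_{T_L,T_R} f dπ_{T'} ≤ γ (2 - (T_L+T_R)/T') ∫ f dπ_{T'}`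
for `f ≥ 0` (one more integration by parts in the tree identity
`pinnedChain_integral_generator_gibbsMeasure`: `∫ L f dπ_{T'} = γ ∑_b (1 - T_b/T') ∫ (1 - p_b²/T') f dπ_{T'}`),
whence `π_{T'} P^{T_L,T_R}_t ≤ e^{γ(2-(T_L+T_R)/T') t} π_{T'}`: the δ-dynamics started from a
Gibbs state never grows heavier tails than a hotter Gibbs state, which is the entry point of the
`χ²(μ_δ | π_T) < ∞` identification stub (K3 of the card). -/
theorem generator_integral_hotterGibbs_le (ω₂ lam β γ : ℝ) (hγ : 0 ≤ γ) (N : ℕ)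
    {T' T_L T_R : ℝ} (hT' : 0 < T') (hL : T_L ≤ T') (hR : T_R ≤ T')
    {f : PhaseSpace N → ℝ} (hf : ContDiff ℝ 2 f) (hfc : HasCompactSupport f)
    (hf0 : ∀ x, 0 ≤ f x) :
    ∫ x, (pinnedChain ω₂ lam β γ).generator N T_L T_R f x
        ∂((pinnedChain ω₂ lam β γ).gibbsMeasure N T') ≤
      γ * (2 - (T_L + T_R) / T') * ∫ x, f x ∂((pinnedChain ω₂ lam β γ).gibbsMeasure N T') := by
  sorry

end Summit.AtomisticToContinuum.FouriersLaw.Cruxes.FiniteResponseOfUnique.Sketch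

end
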